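import Mathlib
import HarnessLib
import Summits.HubbardSuperconductivity.HubbardSuperconductivity.Theorems.KLProgrammeKLRegimeEngineTowerBlockIncrLevOrientedKitF
import Summits.HubbardSuperconductivity.HubbardSuperconductivity.Theorems.KLProgrammeKLRegimeEngineTowerLevStepLinkUniform
import Summits.HubbardSuperconductivity.HubbardSuperconductivity.Theorems.KLProgrammeKLRegimeEngineTowerDoorToKitOrientedRetruncate
import Literature.MathematicalPhysics.QuantumLattice.SectorisedKernelNormExtraction

/-!
# Route `KLProgramme` — crux K3 ENGINE (stmt-HubbardSuperconductivity-20437 `KLRegimeEngineV17F2`), stub (b) v2, THE LEVELS PACKAGE (ℓ), located-risk #10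
# residual «(ℓ)-LINK-UNIFORM-F» (pen (R301)), PART 1: the floor arrays in the kit's product units, the tail / first-order majorants, degree `0`
# (cell gate-hubbard-kl, seat hubbard-kl-k3c2-p3 g14; floor twins of …TowerLevStepLink §1 (p4 g18) — E1 / the LINK-F lane may rename or supersede)

k3c3-p2's `klTowerBornLev_le_kit_orientedF9` (…TowerBlockIncrLevOrientedKitF, p680605) bounds the born levelled array of block `k ≥ 1` at level `F` by the
oriented kit bracket over the CONCRETE graded floor array `Bm m = ε·klTowerMuLevF … d k m·klLevUnitF β M 0 m (dk−1)/27` of #16's door instance, modulo a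
track-blind tail majorant `Nt` (`ε·klTowerMeasLev … (2m) 0 ≤ Nt m`, `Nt 0 = 0`) and a first-order majorant `NF` at the two levels `c ∈ {F−1, F}`.  This file
supplies, for the unit algebra of PART 2 (…TowerLevStepLinkUniformF):

* §1 **`klTowerMeasLev_degree_zero_of_partitionFn`** — in degree `0` every level of the measured array vanishes once
  `Z^K_{Λ_{dk}} ≠ 0` (the degree-`0` sectorised kernel is the constant part, `sectorisedKernel_zero_degree`, `constPart_klEffectiveAction_eq_zero`); so `Nt := Bm` is admissible at `m = 0`;
* §2 `klLevUnitF_zero_track_eq_units` (`klLevUnitF β M 0 p J = (ε·Kc_J)·u_J^p`, `u_J = 8^J·ε²`, `Kc_J = 2^{−5J}·ε^{−2}`, `p ≥ 1`),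
  `klLevUnitF_eq_pow_inv_mul_units` (track `t`: the extra `2^{−klLevGain t·J}`), **`towerBmF_eq_units`** (`Bm = fun m ↦ (ε·Kc)·(u^m·μd m)` as FUNCTIONS, with
  `μd m = (32ε/27)·(1/8)^m·klTowerMuLevF … d k m` — one family step `dk−1 → dk` is the factor `32/8^m = 1/klLevRatioF 0 m`);
* §3 the majorant rows on `Bm`: `imagTimeWeight_mul_klTowerMeasLev_zero_le_towerBmF` (`ε·klTowerMeasLev (2m) 0 ≤ Bm m`, every `m`), `towerNF_row_le`
  (`27^c·ε·B m c ≤ 27^F·θ^{lumps F}·Bm m` for `F ≤ c+1`, `c ≤ F`, `B` = the pin-credited family of …TowerLevOrientedDictF, `θ = (1/2)^{dk−1}`);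
* §4 `towerTheta_pow_mul_two_pow` (`θ^{g}·2^{g·dk} = 2^g`, `1 ≤ dk`), `pow27_mul_two_pow_le` (`27^{t+1}·2^{klLevGain t} ≤ 4·27^5`).
Proofs only; nothing about the model is asserted; nothing asserts (ℓ), any stub, K3 or superconductivity.
References: BGM 2006 §2.8 (2.76)–(2.84), (2.93)–(2.98), §3 (3.2)–(3.8) [cite: BenfattoGiulianiMastropietro2006].
-/

noncomputable section

namespace Summit.HubbardSuperconductivity.HubbardSuperconductivity.Theorems.EngineV8

set_option linter.dupNamespace false -- summit = problem name (single-conjunct summit), D-0017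

open Classical
open Real Finset Literature.MathematicalPhysics.QuantumLattice Literature.Probability.LatticeModels GrassmannAlgebra
open Literature.MathematicalPhysics.QuantumLattice.FermiRG Literature.MathematicalPhysics.QuantumLattice.FermiRG.BGM2006Routing
open Summit.HubbardSuperconductivity.HubbardSuperconductivity.Theorems.KLProgrammeLegKernels
open Summit.HubbardSuperconductivity.HubbardSuperconductivity.Theorems.KLRegimeSplit
open Summit.HubbardSuperconductivity.HubbardSuperconductivity.Theorems.KLRegimeWick
open Summit.HubbardSuperconductivity.HubbardSuperconductivity.Theorems.TwoPointAssembly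
open Summit.HubbardSuperconductivity.HubbardSuperconductivity.Theorems.DispersionFlow

variable {L M : ℕ} [NeZero L] [NeZero M]

/-! ## §1 Degree `0`: every level of the measured array vanishes -/

omit [NeZero M] in
/-- **In degree `0` every level of the measured array vanishes** once `Z^K_{Λ_{dk}} ≠ 0` (positive levels are empty; level `0` is the constant part of
`𝒱_{dk}`, which is `0`). -/
theorem klTowerMeasLev_degree_zero_of_partitionFn (β U μ : ℝ) (K : TrigPolyC4v) (d k : ℕ)
    (hZ : hubbardEffPartitionFnCT L M β U μ 0 K (klScale klE0 (d * k)) ≠ 0) (F : ℕ) : klTowerMeasLev L M β U μ K d k 0 F = 0 := by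
  rcases Nat.eq_zero_or_pos F with rfl | hF
  · have hG0 : constPart ℂ (klTowerInput L M β U μ K d k) = 0 := constPart_klEffectiveAction_eq_zero β U μ K klE0 (d * k) hZ
    unfold klTowerMeasLev
    refine le_antisymm (Real.iSup_le (fun Ωe => le_of_eq ?_) le_rfl) (Real.iSup_nonneg fun Ωe => ?_)
    · rw [klLevNormOf, hubbardSectorKernelNorm_def, sectorisedKernelNorm_zero_left]
      exact sum_eq_zero fun Ω _ => by rw [sectorisedKernel_zero_degree, hG0, norm_zero]
    · rw [klLevNormOf, hubbardSectorKernelNorm_def, sectorisedKernelNorm_zero_left]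
      exact sum_nonneg fun Ω _ => norm_nonneg _
  · exact klTowerMeasLev_eq_zero_of_lt β U μ K d k hF

/-! ## §2 The floor unit and the graded floor array in the kit's product units -/

omit [NeZero L] in
/-- **The track-`0` floor unit in product form**: `klLevUnitF β M 0 p J = (ε·(2^{5J})⁻¹·(ε²)⁻¹)·(8^J·ε²)^p` (`p ≥ 1`, `ε = imagTimeWeight β M > 0`). -/
theorem klLevUnitF_zero_track_eq_units {β : ℝ} (hβ : 0 < β) {p : ℕ} (hp : 1 ≤ p) (J : ℕ) :
    klLevUnitF β M 0 p J =
      (imagTimeWeight β M * ((((2 : ℝ) ^ (5 * J)))⁻¹ * (imagTimeWeight β M ^ 2)⁻¹)) * (((8 : ℝ) ^ J * imagTimeWeight β M ^ 2) ^ p) := by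
  have hx : 0 < imagTimeWeight β M := imagTimeWeight_pos_of_pos (M := M) hβ
  unfold klLevUnitF
  rw [show klLevGain 0 * J = 0 by rw [show klLevGain 0 = 0 from rfl, zero_mul], pow_zero, mul_one]
  obtain ⟨p', rfl⟩ : ∃ p', p = p' + 1 := ⟨p - 1, by omega⟩
  rw [show 2 * (p' + 1) - 1 = 2 * p' + 1 by omega, mul_pow, ← pow_mul, ← pow_mul]
  have h8 : (8 : ℝ) ^ (J * (p' + 1)) = ((8 : ℝ) ^ J) ^ (p' + 1) := by rw [pow_mul]
  rw [h8]
  field_simp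
  ring

omit [NeZero L] in
/-- **Any track's floor unit in product form**: `klLevUnitF β M t p J = (2^{klLevGain t·J})⁻¹·((ε·(2^{5J})⁻¹·(ε²)⁻¹)·(8^J·ε²)^p)` (`p ≥ 1`). -/
theorem klLevUnitF_eq_pow_inv_mul_units {β : ℝ} (hβ : 0 < β) (t : Fin 5) {p : ℕ} (hp : 1 ≤ p) (J : ℕ) :
    klLevUnitF β M t p J = ((2 : ℝ) ^ (klLevGain t * J))⁻¹ *
      ((imagTimeWeight β M * ((((2 : ℝ) ^ (5 * J)))⁻¹ * (imagTimeWeight β M ^ 2)⁻¹)) * (((8 : ℝ) ^ J * imagTimeWeight β M ^ 2) ^ p)) := by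
  rw [klLevUnitF_eq_zero_track_div, klLevUnitF_zero_track_eq_units hβ hp, div_eq_inv_mul]

/-- **THE GRADED FLOOR ARRAY IN PRODUCT UNITS, AS A FUNCTION** (`1 ≤ dk`): with `u = 8^{dk}·ε²`, `Kc = (2^{5dk})⁻¹·(ε²)⁻¹`,
`μd m = (32ε/27)·(1/8)^m·klTowerMuLevF … d k m`:  `(m ↦ ε·klTowerMuLevF … m·klLevUnitF β M 0 m (dk−1)/27) = (m ↦ (ε·Kc)·(u^m·μd m))`
(degree `0`: both sides vanish, `klTowerMuLevF_degree_zero`; `m ≥ 1`: one family step `klLevUnitF … (dk−1)·klLevRatioF 0 m = klLevUnitF … (dk)`). -/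
theorem towerBmF_eq_units {β : ℝ} (hβ : 0 < β) (U μ : ℝ) (K : TrigPolyC4v) {d k : ℕ} (hdk : 1 ≤ d * k) :
    (fun m : ℕ => imagTimeWeight β M * klTowerMuLevF L M β U μ K d k m * klLevUnitF β M 0 m (d * k - 1) / 27) =
      fun m : ℕ => (imagTimeWeight β M * ((((2 : ℝ) ^ (5 * (d * k))))⁻¹ * (imagTimeWeight β M ^ 2)⁻¹)) *
        ((((8 : ℝ) ^ (d * k) * imagTimeWeight β M ^ 2) ^ m) *
          (32 * imagTimeWeight β M / 27 * (1 / 8 : ℝ) ^ m * klTowerMuLevF L M β U μ K d k m)) := by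
  have hx : 0 < imagTimeWeight β M := imagTimeWeight_pos_of_pos (M := M) hβ
  funext m
  rcases Nat.eq_zero_or_pos m with rfl | hm
  · rw [klTowerMuLevF_degree_zero]; simp
  · have hstep : klLevUnitF β M 0 m (d * k - 1) * klLevRatioF 0 m = klLevUnitF β M 0 m (d * k) := by
      rw [← klLevUnitF_succ, Nat.sub_add_cancel hdk]
    have hr0 : 0 < klLevRatioF 0 m := klLevRatioF_pos 0 m
    have hunit' : klLevUnitF β M 0 m (d * k - 1) = klLevUnitF β M 0 m (d * k) / klLevRatioF 0 m := by
      rw [← hstep, mul_div_cancel_right₀ _ hr0.ne']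
    have hratio : klLevRatioF 0 m = (8 : ℝ) ^ m / (32 * (2 : ℝ) ^ klLevGain 0) := rfl
    rw [hunit', klLevUnitF_zero_track_eq_units hβ hm, hratio, show klLevGain 0 = 0 from rfl, pow_zero, mul_one, one_div, inv_pow]
    field_simp

/-! ## §3 The tail and first-order majorants on the graded floor array -/

/-- **The level-`0` measured array under the graded floor array**: `ε·klTowerMeasLev … d k (2m) 0 ≤ Bm m` for EVERY `m` (`Z^K_{Λ_{dk}} ≠ 0` for `m = 0`;
for `m ≥ 1` levels `0` and `1` coincide and level `1` is the floor row at `lumps 1 = 0`). -/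
theorem imagTimeWeight_mul_klTowerMeasLev_zero_le_towerBmF {β : ℝ} (hβ : 0 < β) (U μ : ℝ) (K : TrigPolyC4v) (d k : ℕ)
    (hZ : hubbardEffPartitionFnCT L M β U μ 0 K (klScale klE0 (d * k)) ≠ 0) (m : ℕ) :
    imagTimeWeight β M * klTowerMeasLev L M β U μ K d k (2 * m) 0 ≤
      (fun m : ℕ => imagTimeWeight β M * klTowerMuLevF L M β U μ K d k m * klLevUnitF β M 0 m (d * k - 1) / 27) m := by
  rcases Nat.eq_zero_or_pos m with rfl | hm
  · rw [Nat.mul_zero, klTowerMeasLev_degree_zero_of_partitionFn β U μ K d k hZ 0, mul_zero]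
    exact towerBmF_nonneg hβ U μ K d k 0
  · obtain ⟨m', rfl⟩ : ∃ m', m = m' + 1 := ⟨m - 1, by omega⟩
    rw [show 2 * (m' + 1) = 2 * m' + 1 + 1 by ring, klTowerMeasLev_zero_eq_one hβ.le U μ K d k (2 * m' + 1),
      show 2 * m' + 1 + 1 = 2 * (m' + 1) by ring]
    have h := imagTimeWeight_mul_klTowerMeasLev_le_floor (L := L) (M := M) hβ U μ K d k (m' + 1) (Lv := 1) le_rfl
    rw [show lumps 1 = 0 by rfl, pow_zero, mul_one] at h
    exact h

/-- **The first-order majorant row at the levels `c ∈ {F−1, F}`**: for the pin-credited full-pin family `B` of …TowerLevOrientedDictF,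
`27^c·ε·B m c ≤ 27^F·((1/2)^{dk−1})^{lumps F}·Bm m` whenever `F ≤ c + 1` and `c ≤ F` (`Z^K_{Λ_{dk}} ≠ 0`). -/
theorem towerNF_row_le {β : ℝ} (hβ : 0 < β) (U μ : ℝ) (K : TrigPolyC4v) (d k : ℕ)
    (hZ : hubbardEffPartitionFnCT L M β U μ 0 K (klScale klE0 (d * k)) ≠ 0) (F m c : ℕ) (hFc : F ≤ c + 1) (hcF : c ≤ F) :
    (27 : ℝ) ^ c * (imagTimeWeight β M *
        (if c = 0 then klTowerMeasLev L M β U μ K d k (2 * m) 0 else klTowerMeasLev L M β U μ K d k (2 * m) (c + 1))) ≤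
      (27 : ℝ) ^ F * (((1 / 2 : ℝ) ^ (d * k - 1)) ^ lumps F *
        (fun m : ℕ => imagTimeWeight β M * klTowerMuLevF L M β U μ K d k m * klLevUnitF β M 0 m (d * k - 1) / 27) m) := by
  have hBm0 := towerBmF_nonneg (L := L) (M := M) hβ U μ K d k m
  have h27 : (27 : ℝ) ^ c ≤ (27 : ℝ) ^ F := pow_le_pow_right₀ (by norm_num) hcF
  have hθ1 : ((1 / 2 : ℝ) ^ (d * k - 1)) ^ lumps F ≤ 1 := towerTheta_pow_lumps_le_one _ _
  have hθ0 : 0 ≤ ((1 / 2 : ℝ) ^ (d * k - 1)) ^ lumps F := by positivity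
  refine mul_le_mul h27 ?_ (mul_nonneg (imagTimeWeight_nonneg hβ.le M) (by split_ifs <;> exact klTowerMeasLev_nonneg hβ.le U μ K d k _ _))
    (by positivity)
  split_ifs with hc
  · -- `c = 0`, `F ≤ 1`: `lumps F = 0`
    subst hc
    have hl : lumps F = 0 := by unfold lumps; omega
    rw [hl, pow_zero, one_mul]
    exact imagTimeWeight_mul_klTowerMeasLev_zero_le_towerBmF hβ U μ K d k hZ m
  · -- `c ≥ 1`: the floor row at level `c + 1 ≥ F`
    have h := imagTimeWeight_mul_klTowerMeasLev_le_floor (L := L) (M := M) hβ U μ K d k m (Lv := c + 1) (by omega)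
    refine h.trans ?_
    rw [mul_comm]
    refine mul_le_mul_of_nonneg_right ?_ hBm0
    exact pow_le_pow_of_le_one (by positivity) (pow_le_one₀ (by norm_num) (by norm_num)) (by unfold lumps; omega)

/-! ## §4 Two numeric rows of the division by the output unit -/

omit [NeZero L] [NeZero M] in
/-- **The floor weight against the output unit's level factor**: `((1/2)^{dk−1})^g·2^{g·dk} = 2^g` (`1 ≤ dk`). -/
theorem towerTheta_pow_mul_two_pow {d k : ℕ} (hdk : 1 ≤ d * k) (g : ℕ) :
    ((1 / 2 : ℝ) ^ (d * k - 1)) ^ g * (2 : ℝ) ^ (g * (d * k)) = (2 : ℝ) ^ g := by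
  obtain ⟨J, hJ⟩ : ∃ J, d * k = J + 1 := ⟨d * k - 1, by omega⟩
  rw [hJ, Nat.add_sub_cancel, ← pow_mul, one_div, inv_pow, show g * (J + 1) = (J * g) + g by ring, pow_add]
  have h2 : (2 : ℝ) ^ (J * g) ≠ 0 := pow_ne_zero _ two_ne_zero
  field_simp

omit [NeZero L] [NeZero M] in
/-- `27^{t+1}·2^{klLevGain t} ≤ 4·27^5` for every track. -/
theorem pow27_mul_two_pow_klLevGain_le (t : Fin 5) : (27 : ℝ) ^ ((t : ℕ) + 1) * (2 : ℝ) ^ klLevGain t ≤ 4 * (27 : ℝ) ^ 5 := by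
  have ht : (t : ℕ) + 1 ≤ 5 := by have := t.isLt; omega
  have hg : klLevGain t ≤ 2 := klLevGain_le_two t
  calc (27 : ℝ) ^ ((t : ℕ) + 1) * (2 : ℝ) ^ klLevGain t ≤ (27 : ℝ) ^ 5 * (2 : ℝ) ^ 2 :=
        mul_le_mul (pow_le_pow_right₀ (by norm_num) ht) (pow_le_pow_right₀ (by norm_num) hg) (by positivity) (by positivity)
    _ = 4 * (27 : ℝ) ^ 5 := by norm_num

end Summit.HubbardSuperconductivity.HubbardSuperconductivity.Theorems.EngineV8

end
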